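import Mathlib
import Literature.NumberTheory.Automorphic.GreenRhoEichlerIntegral
import Literature.NumberTheory.ModularForms.DiscriminantOverE4SqAxisIntegral
import HarnessLib

/-!
# Zhou 2015, Remark 9 (ii)a: `G₂^{PSL₂(ℤ)}((1+i√3)/2, i) = −(16π/3) ∫₀¹ P_{−1/6}(ξ)² dξ`

[topic NumberTheory/Automorphic]

Support file for `Literature.NumberTheory.Automorphic.Zhou2015_legendreP_sq_integral`: the
level-one Green-function identity of Zhou 2015, Remark 9, in the tree's normalisation
`higherGreen 1 2 1 cmRho UpperHalfPlane.I = -(16π/3) * ∫ ξ in 0..1, legendreP (-1/6) ξ ^ 2`,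
obtained by feeding the two real-axis inputs of
`Literature.NumberTheory.ModularForms.DiscriminantOverE4SqAxisIntegral`
(`Δ(it)/E₄(it)² ∈ ℝ` and `∫_{t>1} Δ(it)/E₄(it)² dt = (1728π)⁻¹ ∫₀¹ P_{−1/6}²`) into
`GreenRho.higherGreen_cmRho_I_of_axis` (Eichler-integral construction of `G₂(·, ρ')` and uniqueness
of resolvent Green functions).

## References
* Y. Zhou, *Kontsevich–Zagier integrals for automorphic Green's functions. I*, Ramanujan J. 38
  (2015), Remark 9. [cite: Zhou2015, Remark 9]
-/

noncomputable section

open UpperHalfPlane hiding I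
open Complex Real Set MeasureTheory

namespace Literature.NumberTheory.Automorphic

open Literature.NumberTheory.ModularForms Literature.NumberTheory.EllipticCurves.ModularForms

/-- **Zhou 2015, Remark 9 (ii)a (level one).**
`G₂^{PSL₂(ℤ)}((1+i√3)/2, i) = −(16π/3) ∫₀¹ (P_{−1/6}(ξ))² dξ`. [cite: Zhou2015, Remark 9] -/
theorem higherGreen_one_two_one_cmRho_I :
    higherGreen 1 2 1 cmRho UpperHalfPlane.I =
      -(16 * π / 3) * ∫ ξ in (0 : ℝ)..1, legendreP (-1 / 6) ξ ^ 2 :=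
  GreenRho.higherGreen_cmRho_I_of_axis (r := fun t => (e₄ t ^ 3 - e₆ t ^ 2) / (1728 * e₄ t ^ 2))
    (fun t ht => by simpa [GreenRho.fΔE4] using discriminant_div_E₄_sq_axisPt ht)
    (by simpa [GreenRho.fΔE4] using integral_discriminant_div_E₄_sq_axis)

end Literature.NumberTheory.Automorphic
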